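import Literature.NumberTheory.Transcendental.CurvePeriodsChartPathsProofs
import Mathlib.Analysis.Calculus.BumpFunction.InnerProduct
import HarnessLib

/-!
# Periods of curve type: moving a path through a prescribed algebraic point

Companion of `Literature/NumberTheory/Transcendental/CurvePeriods.lean` (Huber–Wüstholz 2022,
Thm. 13.3 (2), rendered on explicit period symbols `(Z, ω, γ)` with the elementary relations
(R1)–(R5); the general statement is the named fact `HuberWustholzCurvePeriods`). Relation (R5)
only sees `C¹` triangles with ALGEBRAIC vertices, and the subdivision relation
(`rel_subdivision`) only cuts a path at an algebraic point. To cut a `C¹` path `γ` at an arbitrary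
parameter `t₀ ∈ (0,1)` one first moves it, inside a holomorphic chart of `Z` at `γ(t₀)`
(`CurvePeriodsChartsProofs.lean`), through a prescribed nearby algebraic point `a` of `Z`
(such points are dense, `CurvePeriodsAlgebraicPointsProofs.lean`):

* `exists_adjust` — given a chart `(i₀, ε, Ω, ψ)` of `Z` centred at `γ(t₀)`, an algebraic point
  `a ∈ Z(ℂ) ∩ Ω` with `|a_{i₀} − γ(t₀)_{i₀}| < ε/2` and `ρ > 0`, there is a `C¹` path `γ′` on `Z`
  with `γ′(t₀) = a`, `γ′ = γ` at distance `≥ ρ` from `t₀`, `γ′(t) ∈ Ω` wherever `γ′(t) ≠ γ(t)`,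
  and `(Z, ω, γ) ∼ (Z, ω, γ′)` for every `ω`. Construction: `γ′(t) = ψ(γ(t)_{i₀} + β(t) d)` near
  `t₀`, `d = a_{i₀} − γ(t₀)_{i₀}`, with `β` a smooth bump function at `t₀` (`ContDiffBump`),
  `β(t₀) = 1`; the `C¹` homotopy `ψ(γ(t)_{i₀} + s β(t) d)` with fixed end points gives the
  relation (`span_single_sub_single_of_homotopy`).

This is the device by which the break points of a subdivision, or the vertices of a grid
cutting a homotopy, are made algebraic (book §3.3.1: chains with end points in `Y(k)`).

## References

* A. Huber, G. Wüstholz, *Transcendence and Linear Relations of 1-Periods*, Cambridge Tracts in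
  Mathematics 227, CUP 2022 [HuberWustholz2022]: §3.3.1 (pp. 42–44 of the held text), Thm. 13.3 (2)
  (p. 121).
-/

noncomputable section

open scoped BigOperators Topology
open MvPolynomial Set Filter Metric

namespace Literature.NumberTheory.Transcendental

namespace CurvePeriods

set_option quotPrecheck false in
/-- Membership in the `ℚ̄`-span of the elementary relations, in the format of the conclusion of
`HuberWustholzCurvePeriods`. -/
local notation "InSpan" c:max => ∃ (k : ℕ) (ρ : Fin k → (PeriodSymbol →₀ ℂ)) (a : Fin k → ℂ),
  (∀ l, IsElementaryRelation (ρ l)) ∧ (∀ l, IsAlgebraic ℚ (a l)) ∧ c = ∑ l, a l • ρ l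

variable {Z : CurveData}

/-- A `C¹` path on `[0,1]` is `C¹` at every interior parameter. [folklore] -/
theorem CurvePath.contDiffAt (γ : CurvePath Z) {t : ℝ} (ht : t ∈ Ioo (0 : ℝ) 1) :
    ContDiffAt ℝ 1 γ.toFun t :=
  γ.contDiffOn.contDiffAt (Icc_mem_nhds ht.1 ht.2)

/-- **Moving a path through a prescribed algebraic point of a chart.** Let `γ` be a `C¹` path on
`Z`, `t₀ ∈ (0,1)`, `(i₀, ε, Ω, ψ)` a holomorphic chart of `Z` centred at `γ(t₀)` (as provided by
`exists_localChart`/`exists_localChart_subset`), `a ∈ Z(ℂ) ∩ Ω` a point (an algebraic one in the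
applications) with `|a_{i₀} − γ(t₀)_{i₀}| < ε / 2`, and `ρ > 0`. Then there is a `C¹` path `γ′` on `Z` with the same
end points such that `γ′(t₀) = a`, `γ′(t) = γ(t)` whenever `dist(t, t₀) ≥ ρ`, every value of
`γ′` is either the value of `γ` or a point of `Ω`, and `(Z, ω, γ) − (Z, ω, γ′)` lies in the span
of the elementary relations for every form `ω` over `ℚ̄`.
[cite: HuberWustholz2022, §3.3.1 (pp. 42–44)] -/
theorem exists_adjust (hZ : Z.IsSmoothAffineCurve) (ω : Fin Z.n → MvPolynomial (Fin Z.n) ℂ)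
    (h : ∀ i, HasAlgCoeffs (ω i)) (γ : CurvePath Z) {t₀ : ℝ} (ht₀ : t₀ ∈ Ioo (0 : ℝ) 1)
    {i₀ : Fin Z.n} {ε : ℝ} {Ω : Set (Fin Z.n → ℂ)} {ψ : ℂ → (Fin Z.n → ℂ)}
    (hψ : AnalyticOnNhd ℂ ψ (ball (γ.toFun t₀ i₀) ε))
    (h1 : ∀ z ∈ Ω, z ∈ Z.points → z i₀ ∈ ball (γ.toFun t₀ i₀) ε ∧ ψ (z i₀) = z)
    (h2 : ∀ w ∈ ball (γ.toFun t₀ i₀) ε, ψ w ∈ Ω ∧ ψ w ∈ Z.points ∧ ψ w i₀ = w)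
    (hΩo : IsOpen Ω) (hγΩ : γ.toFun t₀ ∈ Ω) {a : Fin Z.n → ℂ} (haZ : a ∈ Z.points) (haΩ : a ∈ Ω)
    (ha2 : a i₀ ∈ ball (γ.toFun t₀ i₀) (ε / 2)) {ρ : ℝ} (hρ : 0 < ρ) :
    ∃ γ' : CurvePath Z, γ'.toFun t₀ = a ∧ (∀ t, ρ ≤ dist t t₀ → γ'.toFun t = γ.toFun t) ∧
      (∀ t, γ'.toFun t = γ.toFun t ∨ γ'.toFun t ∈ Ω) ∧ γ'.toFun 0 = γ.toFun 0 ∧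
      γ'.toFun 1 = γ.toFun 1 ∧
      InSpan (Finsupp.single (⟨Z, hZ, ω, h, γ⟩ : PeriodSymbol) (1 : ℂ) -
        Finsupp.single ⟨Z, hZ, ω, h, γ'⟩ 1) := by
  have hI0 : (0 : ℝ) ∈ Icc (0 : ℝ) 1 := ⟨le_rfl, zero_le_one⟩
  have hI1 : (1 : ℝ) ∈ Icc (0 : ℝ) 1 := ⟨zero_le_one, le_rfl⟩
  -- notation
  set c : ℂ := γ.toFun t₀ i₀ with hc
  set w : ℝ → ℂ := fun t => γ.toFun t i₀ with hw
  set d : ℂ := a i₀ - c with hd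
  have hdlt : ‖d‖ < ε / 2 := by rw [hd, ← dist_eq_norm]; exact ha2
  have hεpos : 0 < ε := by linarith [norm_nonneg d]
  -- a window `|t − t₀| < ρ'` inside `(0,1)` on which `γ(t) ∈ Ω` and `|w(t) − c| < ε / 2`
  have hγc : ContinuousAt γ.toFun t₀ := (γ.contDiffAt ht₀).continuousAt
  have hwc : ContinuousAt w t₀ := (continuous_apply i₀).continuousAt.comp hγc
  have hpre : ∀ᶠ t in 𝓝 t₀, t ∈ Ioo (0 : ℝ) 1 ∧ γ.toFun t ∈ Ω ∧ dist (w t) c < ε / 2 := by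
    filter_upwards [Ioo_mem_nhds ht₀.1 ht₀.2, hγc.preimage_mem_nhds (hΩo.mem_nhds hγΩ),
      hwc.preimage_mem_nhds (isOpen_ball.mem_nhds
        (mem_ball_self (half_pos hεpos) : w t₀ ∈ ball c (ε / 2)))] with t h₁ h₂ h₃
    exact ⟨h₁, h₂, h₃⟩
  obtain ⟨ρ₁, hρ₁, hball⟩ := Metric.eventually_nhds_iff_ball.mp hpre
  set ρ' : ℝ := min ρ ρ₁ with hρ'
  have hρ'pos : 0 < ρ' := lt_min hρ hρ₁
  have hwin : ∀ t, dist t t₀ < ρ' → t ∈ Ioo (0 : ℝ) 1 ∧ γ.toFun t ∈ Ω ∧ dist (w t) c < ε / 2 :=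
    fun t ht => hball t (lt_of_lt_of_le ht (min_le_right _ _))
  -- the bump function
  let β : ContDiffBump t₀ := ⟨ρ' / 4, ρ' / 2, by positivity, by linarith⟩
  have hβ0 : ∀ t, ρ' / 2 ≤ dist t t₀ → β t = 0 := fun t ht => β.zero_of_le_dist ht
  have hβ1 : β t₀ = 1 := β.one_of_mem_closedBall (mem_closedBall_self (by positivity))
  have hβI : ∀ t, (β t : ℝ) ∈ Icc (0 : ℝ) 1 := fun t => ⟨β.nonneg, β.le_one⟩
  -- the modified lift stays in the disc
  have hlift : ∀ (s : ℝ) (t : ℝ), s ∈ Icc (0 : ℝ) 1 → dist t t₀ < ρ' →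
      w t + ((s * β t : ℝ) : ℂ) * d ∈ ball c ε := by
    intro s t hs ht
    rw [mem_ball, dist_eq_norm]
    have hsβ : |s * β t| ≤ 1 := by
      rw [abs_mul, abs_of_nonneg hs.1, abs_of_nonneg β.nonneg]
      exact mul_le_one₀ hs.2 β.nonneg β.le_one
    calc ‖w t + ((s * β t : ℝ) : ℂ) * d - c‖ = ‖(w t - c) + ((s * β t : ℝ) : ℂ) * d‖ := by ring_nf
      _ ≤ ‖w t - c‖ + ‖((s * β t : ℝ) : ℂ) * d‖ := norm_add_le _ _
      _ = dist (w t) c + |s * β t| * ‖d‖ := by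
          rw [dist_eq_norm, norm_mul, Complex.norm_real, Real.norm_eq_abs]
      _ < ε / 2 + 1 * (ε / 2) := by
          gcongr ?_ + ?_
          · exact (hwin t ht).2.2
          · calc |s * β t| * ‖d‖ ≤ 1 * ‖d‖ := by gcongr
              _ < 1 * (ε / 2) := by gcongr
      _ = ε := by ring
  -- the homotopy `K(s, t)` and the new path `K(1, ·)`
  let K : ℝ × ℝ → (Fin Z.n → ℂ) := fun q =>
    if dist q.2 t₀ < ρ' then ψ (w q.2 + ((q.1 * β q.2 : ℝ) : ℂ) * d) else γ.toFun q.2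
  have hKout : ∀ (s t : ℝ), ρ' / 2 ≤ dist t t₀ → t ∈ Icc (0 : ℝ) 1 → K (s, t) = γ.toFun t := by
    intro s t ht htI
    show (if dist t t₀ < ρ' then ψ (w t + ((s * β t : ℝ) : ℂ) * d) else γ.toFun t) = γ.toFun t
    split_ifs with hlt
    · rw [hβ0 t ht, mul_zero, Complex.ofReal_zero, zero_mul, add_zero]
      exact (h1 _ (hwin t hlt).2.1 (γ.mem_points t htI)).2
    · rfl
  have hKin : ∀ (s t : ℝ), dist t t₀ < ρ' → K (s, t) = ψ (w t + ((s * β t : ℝ) : ℂ) * d) :=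
    fun s t ht => if_pos ht
  have hK0 : K (0, 0) = γ.toFun 0 ∧ ∀ s, K (s, 0) = γ.toFun 0 := by
    have h0 : ρ' / 2 ≤ dist 0 t₀ := by
      have hn : ¬ dist (0 : ℝ) t₀ < ρ' := fun hlt => (lt_irrefl (0 : ℝ)) (hwin 0 hlt).1.1
      linarith [not_lt.mp hn]
    exact ⟨hKout 0 0 h0 hI0, fun s => hKout s 0 h0 hI0⟩
  have hK1 : ∀ s, K (s, 1) = γ.toFun 1 := by
    have h0 : ρ' / 2 ≤ dist 1 t₀ := by
      have hn : ¬ dist (1 : ℝ) t₀ < ρ' := fun hlt => (lt_irrefl (1 : ℝ)) (hwin 1 hlt).1.2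
      linarith [not_lt.mp hn]
    exact fun s => hKout s 1 h0 hI1
  have hKZ : ∀ q ∈ Icc (0 : ℝ) 1 ×ˢ Icc (0 : ℝ) 1, K q ∈ Z.points := by
    rintro ⟨s, t⟩ ⟨hs, ht⟩
    by_cases hlt : dist t t₀ < ρ'
    · rw [hKin s t hlt]; exact (h2 _ (hlift s t hs hlt)).2.1
    · rw [hKout s t (by linarith [not_lt.mp hlt]) ht]; exact γ.mem_points t ht
  -- `K` is `C¹` on the square
  have hψR : ContDiffOn ℝ 1 ψ (ball c ε) := contDiffOn_real_of_analyticOnNhd hψ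
  have hwC : ∀ t, dist t t₀ < ρ' → ContDiffAt ℝ 1 w t := fun t ht =>
    (contDiffAt_pi.mp (γ.contDiffAt (hwin t ht).1)) i₀
  have hKC : ContDiffOn ℝ 1 K (Icc (0 : ℝ) 1 ×ˢ Icc (0 : ℝ) 1) := by
    rintro ⟨s, t⟩ hq
    by_cases hlt : dist t t₀ < ρ'
    · -- inside the window: `ψ ∘ L` with `L(s,t) = w t + s β(t) d`
      have hstrip : {q : ℝ × ℝ | dist q.2 t₀ < ρ'} ∈ 𝓝 (s, t) :=
        (isOpen_lt (continuous_snd.dist continuous_const) continuous_const).mem_nhds hlt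
      have hL : ContDiffOn ℝ 1 (fun q : ℝ × ℝ => w q.2 + ((q.1 * β q.2 : ℝ) : ℂ) * d)
          ((Icc (0 : ℝ) 1 ×ˢ Icc (0 : ℝ) 1) ∩ {q | dist q.2 t₀ < ρ'}) := by
        intro q hq'
        have hwq : ContDiffAt ℝ 1 (fun q : ℝ × ℝ => w q.2) q := (hwC q.2 hq'.2).comp q contDiffAt_snd
        have hsb : ContDiffAt ℝ 1 (fun q : ℝ × ℝ => ((q.1 * β q.2 : ℝ) : ℂ) * d) q :=
          ((Complex.ofRealCLM.contDiff.comp (contDiff_fst.mul (β.contDiff.comp contDiff_snd))).mul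
            contDiff_const).contDiffAt
        exact (hwq.add hsb).contDiffWithinAt
      have hcomp : ContDiffOn ℝ 1 (fun q : ℝ × ℝ => ψ (w q.2 + ((q.1 * β q.2 : ℝ) : ℂ) * d))
          ((Icc (0 : ℝ) 1 ×ˢ Icc (0 : ℝ) 1) ∩ {q | dist q.2 t₀ < ρ'}) :=
        hψR.comp hL fun q hq' => hlift q.1 q.2 hq'.1.1 hq'.2
      have hKeq : EqOn K (fun q : ℝ × ℝ => ψ (w q.2 + ((q.1 * β q.2 : ℝ) : ℂ) * d))
          ((Icc (0 : ℝ) 1 ×ˢ Icc (0 : ℝ) 1) ∩ {q | dist q.2 t₀ < ρ'}) :=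
        fun q hq' => hKin q.1 q.2 hq'.2
      have hw' : ContDiffWithinAt ℝ 1 K ((Icc (0 : ℝ) 1 ×ˢ Icc (0 : ℝ) 1) ∩ {q | dist q.2 t₀ < ρ'})
          (s, t) := (hcomp.congr hKeq) (s, t) ⟨hq, hlt⟩
      exact (contDiffWithinAt_inter hstrip).mp hw'
    · -- outside: `K = γ ∘ snd` near `(s, t)`
      have hge : ρ' ≤ dist t t₀ := not_lt.mp hlt
      have hopen : {q : ℝ × ℝ | ρ' / 2 < dist q.2 t₀} ∈ 𝓝 (s, t) :=
        (isOpen_lt continuous_const (continuous_snd.dist continuous_const)).mem_nhds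
          (by show ρ' / 2 < dist t t₀; linarith)
      have hγ2 : ContDiffWithinAt ℝ 1 (fun q : ℝ × ℝ => γ.toFun q.2) (Icc (0 : ℝ) 1 ×ˢ Icc (0 : ℝ) 1)
          (s, t) := (γ.contDiffOn.comp contDiff_snd.contDiffOn fun q hq' => hq'.2) (s, t) hq
      refine hγ2.congr_of_eventuallyEq ?_ (hKout s t (by linarith) hq.2)
      filter_upwards [mem_nhdsWithin_of_mem_nhds hopen, self_mem_nhdsWithin] with q hq' hqI
      exact hKout q.1 q.2 hq'.le hqI.2
  -- the new path
  let γ' : CurvePath Z :=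
    { toFun := fun t => K (1, t)
      contDiffOn := hKC.comp (contDiff_const.prodMk contDiff_id).contDiffOn fun t ht => ⟨hI1, ht⟩
      mem_points := fun t ht => hKZ (1, t) ⟨hI1, ht⟩
      algebraic_zero := fun i => by rw [hK0.2 1]; exact γ.algebraic_zero i
      algebraic_one := fun i => by rw [hK1 1]; exact γ.algebraic_one i }
  refine ⟨γ', ?_, fun t ht => ?_, fun t => ?_, hK0.2 1, hK1 1, ?_⟩
  · -- `γ'(t₀) = ψ(c + d) = ψ(a i₀) = a`
    show K (1, t₀) = a
    rw [hKin 1 t₀ (by rw [dist_self]; exact hρ'pos), hβ1, mul_one, Complex.ofReal_one, one_mul,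
      hd, add_sub_cancel]
    exact (h1 a haΩ haZ).2
  · -- unchanged at distance `≥ ρ ≥ ρ'`
    show K (1, t) = γ.toFun t
    show (if dist t t₀ < ρ' then ψ (w t + ((1 * β t : ℝ) : ℂ) * d) else γ.toFun t) = γ.toFun t
    rw [if_neg (not_lt.mpr ((min_le_left ρ ρ₁).trans ht))]
  · -- values: `γ(t)` or a point of `Ω`
    show K (1, t) = γ.toFun t ∨ K (1, t) ∈ Ω
    by_cases hlt : dist t t₀ < ρ'
    · right; rw [hKin 1 t hlt]; exact (h2 _ (hlift 1 t hI1 hlt)).1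
    · left
      show (if dist t t₀ < ρ' then ψ (w t + ((1 * β t : ℝ) : ℂ) * d) else γ.toFun t) = γ.toFun t
      rw [if_neg hlt]
  · -- the relation, by homotopy invariance
    refine span_single_sub_single_of_homotopy hZ ω h K hKC hKZ (fun s _ => ?_) (fun s _ => ?_)
      γ γ' (fun t ht => ?_) (fun t _ => rfl)
    · rw [hK0.2 s, hK0.1]
    · rw [hK1 s, ← hK1 0]
    · by_cases hlt : dist t t₀ < ρ'
      · rw [hKin 0 t hlt, zero_mul, Complex.ofReal_zero, zero_mul, add_zero]
        exact ((h1 _ (hwin t hlt).2.1 (γ.mem_points t ht)).2).symm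
      · exact (hKout 0 t (by linarith [not_lt.mp hlt]) ht).symm

end CurvePeriods

end Literature.NumberTheory.Transcendental

end
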